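import Summits.QuantumFields.YangMills.Theorems.UnitScaleTiltProp7CornerBlendSupRows
import Summits.QuantumFields.YangMills.Theorems.UnitScaleTiltProp7PureGaugeOfExpRows
import Summits.QuantumFields.YangMills.Theorems.UnitScaleTiltProp7GaugeActChartRows
import Summits.QuantumFields.YangMills.Theorems.UnitScaleTiltProp7LemmaHCurvedOfRows
import Summits.QuantumFields.YangMills.Theorems.UnitScaleTiltProp7TwistRegauge
import HarnessLib

/-!
# Route `UnitScaleTilt`, crux K1 «MinimiserStabilityRegPr» (stmt-QuantumFields-19200), route-R E′ path (α′), (E1) «pinned slice theorem» — its STARTING POINT (row R2 ∕ (F1′)):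
# THE SMOOTH UNTWISTING — for a σ-small twist `u`, print's Landau representative `X = e^{iA₀}W` and (3.35)-type frames, an untwisted chart `D‴ = −i·log((X^g)_bW_b⁻¹)` on the
# CONSTRAINT FIBRE with BOTH (E1) data rows: `‖D‴ b‖ ≤ s + (1+2s)(1+3M)B₁` AND `‖divB 𝒰 D‴ x‖ ≤ ‖divB 𝒰 A₀ x‖ + d·(…B₁, B₂…)`, `ℓB₁, ℓ²B₂ = O(σ)`

Cell `ym3-torus`, width seat `ym-ust-19200-w1` (gen 12); LOCATE `LOCATE-F1PRIME-SMOOTH-UNTWIST-w1g12.md` (19200 evidence n = 55), file (U3) — the assembly of ✓ `Prop7CornerBlendSupRows`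
(U1), ✓ `Prop7PureGaugeOfExpRows` (U2), ✓ `Prop7GaugeActChartRows` (U2b).  THEOREMS ONLY (0 `def`, 0 `sorry`); `--supports stmt-QuantumFields-19200`, count-neutral.  YM₃ on T³ is a
ladder rung (R3), not the Clay problem; nothing here claims a stub, the crux, d = 4 or the mass gap; (E1) is NOT closed by this file.

WHY.  The (E1) contraction (✓ `Prop7ExactCorrectorContractionGauge.exists_unique_exact_corrector_gauge`) consumes a starting chart `D` with `q D ≤ s`,
`q = max(ℓ·sup‖·‖, ℓ²·sup‖divB 𝒰 ·‖)`.  The untwisted charts of record (✓ `Prop7UntwistChartOfTwist`, trilinear blend) carry the first row only.  Here the twist's centre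
values `u(c_y)` (σ-close to `1`, [Balaban1985RegularSpaces] (1.72)) are interpolated at the LIE-ALGEBRA level by the framed C¹ corner blend `Φ` of `m_y = −i·log u(c_y)` (U1), the
untwisting gauge is `g = expHerm ∘ Φ` (so `g(c_y) = u(c_y)`: membership on the fibre is ✓ `Prop7TwistRegauge.gaugeAct_mem_regFibrePr_of_centre_eq`, the action is gauge
invariant), and the two rows of the chart follow from (U2) (pure-gauge part) and (U2b) (conjugated Landau field + quadratic remainder).  Every constant is explicit; with the (3.35)
frames of ✓ `Prop7LemmaHCurvedFramesOfRegPr.exists_frames_T3_of_regPr` (`ℓa₀, ℓ²a₁ ≤ C′e^{C′}`) the rows read `ℓ‖D‴‖ = O(s₀ + σ)`, `ℓ²‖divB 𝒰 D‴‖ = ℓ²‖divB 𝒰 A₀‖ + O(σ + s₀σ)` —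
k-UNIFORM.  The frames and `A₀`'s rows stay DISPLAYED (door-first), exactly as in ✓ `Prop7LemmaHCurvedOfRows.lemmaH_curved_of_rows`.

WHAT IS PROVED (ns `…Theorems.Prop7SmoothUntwist`).
* §1 letters: `star_eq_inv_of_bicontr` (a bi-contractive unit of `M₂(ℂ)` is unitary), `isHermitian_trace_R` (framed Hermitian-traceless data stay Hermitian-traceless),
  `isHermitian_trace_convex` (convex combinations), `centre_data_rows` (`m_y = −i·log u(c_y)`: Hermitian, traceless, `‖m_y‖ ≤ 2σ`, `expHerm m_y = u(c_y)`).
* §2 ★★★ `exists_smoothUntwistedChart_T3` — see the docstring: `∃ D‴` Hermitian-traceless with the sup row, the DIVERGENCE row, `A(X^u) = A(e^{iD‴}W)` and `e^{iD‴}W ∈ (6)(e) ∩ 𝔅_k(V)`.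
HONEST SCOPE.  Bookkeeping over (U1)(U2)(U2b) and landed letters; displayed: the frame rows `a₀ a₁` (supplier ✓p663714), the twist's centre sup `σ`, `A₀`'s sup `s`; the divergence of
`A₀` appears on the right UNBOUNDED-BY-HYPOTHESIS (the consumer inserts print's (1.36)₂ row `‖divB 𝒰 A₀‖ ≤ s₁′ℓ⁻²`).  Nothing of Bałaban's beyond the cited letters is asserted.

References: T. Bałaban, CMP 99 (1985) 75–102 [Balaban1985RegularSpaces] ((1.29) p.81, (1.36) p.82, Thm 2 p.83, (1.72) p.88); CMP 102 (1985) 277–309 [Balaban1985Variational]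
((4)–(6) p.278, (15) p.280, (112) p.294); CMP 99 (1985) 389–434 [Balaban1985BackgroundPropagators] ((3.3) p.390, (3.8) p.392, (3.35) p.396); CMP 98 (1985) 17–51
[Balaban1985Averaging] ((8) p.19, (21) p.21, (31) p.22).
-/

set_option autoImplicit false

noncomputable section

open scoped BigOperators Matrix.Norms.L2Operator Matrix
open NormedSpace

namespace Summit.QuantumFields.YangMills.Theorems.Prop7SmoothUntwist

open Literature.MathematicalPhysics.QuantumFieldTheory.Balaban1983to89
open Literature.MathematicalPhysics.QuantumFieldTheory.Balaban1983to89.T3ContinuumYM3Torus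
open Literature.MathematicalPhysics.QuantumFieldTheory.Balaban1983to89.T3PrintedRegularMinimiser (regFibrePr)
open Literature.MathematicalPhysics.QuantumFieldTheory.Balaban1983to89.T3SectALandauChart (emb15)
open T4Continuum
open B9Eq39Adjoint (R R_def R_smul covD covDstar divB)
open B9Eq310Hermitian (norm_R_le)
open B9TorusCalculus (torusT)
open B10Eq27TorusAxialLog (unitsField toUField)
open MatrixLog (mlog)
open B5Eq118OneStroke (iterBlockOf)
open B15DeterminingSets (embIter)
open Summit.QuantumFields.YangMills.Theorems.Prop7TPrint (expHerm expHermField coe_expHerm)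
open Summit.QuantumFields.YangMills.Theorems.Prop7BlendSite (coe_inv_SU)
open Summit.QuantumFields.YangMills.Theorems.Prop7UntwistedChartOfBlend (hermLog_isHermitian hermLog_trace norm_hermLog_le expHerm_hermLog)
open Summit.QuantumFields.YangMills.Theorems.Prop7ExactCorrectorGaugeSockets (unitsField_toUField_norm_le_one)
open Summit.QuantumFields.YangMills.Theorems.Prop7TwistRegauge (gaugeAct_mem_regFibrePr_of_centre_eq)
open Summit.QuantumFields.YangMills.Theorems.Prop7LemmaHCurvedOfRows (profile_rows)
open Summit.QuantumFields.YangMills.Theorems.Prop7CornerBlendSupRows (exists_extension_sup_rows)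
open Summit.QuantumFields.YangMills.Theorems.Prop7PureGaugeOfExpRows (norm_ratio_sub_one_le norm_pureGauge_le norm_divB_pureGauge_le)
open Summit.QuantumFields.YangMills.Theorems.Prop7GaugeActChartRows (chart_gaugeAct_isHermitian_trace norm_chart_gaugeAct_le norm_divB_chart_gaugeAct_le)

/-! ## §1 Letters -/

section Letters

/-- **A BI-CONTRACTIVE UNIT OF `M₂(ℂ)` IS UNITARY**: `‖u‖ ≤ 1`, `‖u⁻¹‖ ≤ 1` ⟹ `↑u⁻¹ = (↑u)ᴴ` (the map `x ↦ ux` is an isometry of `ℂ²`; cf. the tree's `uN_mem_unitaryGroup_of_norm_le_one`).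
[folklore] [cite: Balaban1985BackgroundPropagators, (3.35) p.396] -/
theorem star_eq_inv_of_bicontr (u : (Matrix (Fin 2) (Fin 2) ℂ)ˣ) (h1 : ‖(u : Matrix (Fin 2) (Fin 2) ℂ)‖ ≤ 1) (h2 : ‖(((u⁻¹ : (Matrix (Fin 2) (Fin 2) ℂ)ˣ)) : Matrix (Fin 2) (Fin 2) ℂ)‖ ≤ 1) :
    star (u : Matrix (Fin 2) (Fin 2) ℂ) = (((u⁻¹ : (Matrix (Fin 2) (Fin 2) ℂ)ˣ)) : Matrix (Fin 2) (Fin 2) ℂ) := by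
  set T : EuclideanSpace ℂ (Fin 2) →L[ℂ] EuclideanSpace ℂ (Fin 2) := Matrix.toEuclideanCLM (n := Fin 2) (𝕜 := ℂ) (u : Matrix (Fin 2) (Fin 2) ℂ) with hT
  set T' : EuclideanSpace ℂ (Fin 2) →L[ℂ] EuclideanSpace ℂ (Fin 2) := Matrix.toEuclideanCLM (n := Fin 2) (𝕜 := ℂ) (((u⁻¹ : (Matrix (Fin 2) (Fin 2) ℂ)ˣ)) : Matrix (Fin 2) (Fin 2) ℂ) with hT'
  have hTn : ‖T‖ ≤ 1 := by rwa [hT, ← Matrix.cstar_norm_def]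
  have hT'n : ‖T'‖ ≤ 1 := by rwa [hT', ← Matrix.cstar_norm_def]
  have hprod : T' * T = 1 := by rw [hT, hT', ← map_mul, Units.inv_mul, map_one]
  have hTT : ∀ x, T' (T x) = x := fun x => by
    rw [← ContinuousLinearMap.comp_apply, ← ContinuousLinearMap.mul_def, hprod]; rfl
  have hiso : ∀ x, ‖T x‖ = ‖x‖ := fun x => by
    refine le_antisymm ((T.le_opNorm x).trans ?_) ?_
    · calc ‖T‖ * ‖x‖ ≤ 1 * ‖x‖ := by gcongr
        _ = ‖x‖ := one_mul _
    · calc ‖x‖ = ‖T' (T x)‖ := by rw [hTT]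
        _ ≤ ‖T'‖ * ‖T x‖ := T'.le_opNorm _
        _ ≤ 1 * ‖T x‖ := by gcongr
        _ = ‖T x‖ := one_mul _
  have hadj : ContinuousLinearMap.adjoint T ∘L T = 1 := (ContinuousLinearMap.norm_map_iff_adjoint_comp_self T).mp hiso
  have hstar : Matrix.toEuclideanCLM (n := Fin 2) (𝕜 := ℂ) (star (u : Matrix (Fin 2) (Fin 2) ℂ) * (u : Matrix (Fin 2) (Fin 2) ℂ)) =
      Matrix.toEuclideanCLM (n := Fin 2) (𝕜 := ℂ) 1 := by
    rw [map_mul, map_star, map_one, ContinuousLinearMap.star_eq_adjoint, ContinuousLinearMap.mul_def, ← hT, hadj]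
  have hsu : star (u : Matrix (Fin 2) (Fin 2) ℂ) * (u : Matrix (Fin 2) (Fin 2) ℂ) = 1 := Matrix.toEuclideanCLM.injective hstar
  exact (Units.inv_eq_of_mul_eq_one_left hsu).symm

/-- Framed Hermitian-traceless data are Hermitian-traceless: `R(P)m = P·m·Pᴴ` for a bi-contractive (hence unitary) frame `P`. [cite: Balaban1985BackgroundPropagators, (3.35) p.396] -/
theorem isHermitian_trace_R (P : (Matrix (Fin 2) (Fin 2) ℂ)ˣ) (hP : ‖(P : Matrix (Fin 2) (Fin 2) ℂ)‖ ≤ 1 ∧ ‖(((P⁻¹ : (Matrix (Fin 2) (Fin 2) ℂ)ˣ)) : Matrix (Fin 2) (Fin 2) ℂ)‖ ≤ 1)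
    {m : Matrix (Fin 2) (Fin 2) ℂ} (hm : m.IsHermitian ∧ Matrix.trace m = 0) :
    (R P m).IsHermitian ∧ Matrix.trace (R P m) = 0 := by
  have hinv : (((P⁻¹ : (Matrix (Fin 2) (Fin 2) ℂ)ˣ)) : Matrix (Fin 2) (Fin 2) ℂ) = (P : Matrix (Fin 2) (Fin 2) ℂ)ᴴ := by
    rw [← star_eq_inv_of_bicontr P hP.1 hP.2]; rfl
  rw [R_def, hinv]
  refine ⟨Matrix.isHermitian_mul_mul_conjTranspose _ hm.1, ?_⟩
  rw [Matrix.trace_mul_cycle, ← hinv, ← Units.val_mul, inv_mul_cancel, Units.val_one, one_mul, hm.2]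

/-- Convex (indeed any real) combinations of Hermitian-traceless matrices are Hermitian-traceless. [folklore] -/
theorem isHermitian_trace_sum_smul {Y : Type*} [Fintype Y] (w : Y → ℝ) (A : Y → Matrix (Fin 2) (Fin 2) ℂ)
    (hA : ∀ y, (A y).IsHermitian ∧ Matrix.trace (A y) = 0) :
    (∑ y, w y • A y).IsHermitian ∧ Matrix.trace (∑ y, w y • A y) = 0 := by
  refine ⟨?_, ?_⟩
  · exact Finset.sum_induction _ (fun B : Matrix (Fin 2) (Fin 2) ℂ => B.IsHermitian) (fun a b ha hb => ha.add hb) Matrix.isHermitian_zero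
      (fun y _ => (hA y).1.smul (IsSelfAdjoint.all (w y)))
  · rw [Matrix.trace_sum]
    exact Finset.sum_eq_zero fun y _ => by rw [Matrix.trace_smul, (hA y).2, smul_zero]

/-- **THE CENTRE DATA**: for `dist1(u(c_y)) ≤ σ ≤ 1∕3`, `m_y := −i·log ↑u(c_y)` is Hermitian, traceless, `‖m_y‖ ≤ 2σ`, and `expHerm m_y = u(c_y)`.
[cite: Balaban1985RegularSpaces, (1.72) p.88; Balaban1985Averaging, (19)-(21) p.21] -/
theorem centre_data_rows {P : Params} {k : ℕ} (u : GaugeTransf P 0 (Matrix.specialUnitaryGroup (Fin 2) ℂ)) {σ : ℝ}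
    (hσ : ∀ y : Site P k, dist1 (u (embIter k y)) ≤ σ) (hσ3 : σ ≤ 1 / 3) (y : Site P k) :
    ((-Complex.I) • mlog ((u (embIter k y) : Matrix.specialUnitaryGroup (Fin 2) ℂ) : Matrix (Fin 2) (Fin 2) ℂ)).IsHermitian
    ∧ Matrix.trace ((-Complex.I) • mlog ((u (embIter k y) : Matrix.specialUnitaryGroup (Fin 2) ℂ) : Matrix (Fin 2) (Fin 2) ℂ)) = 0
    ∧ ‖(-Complex.I) • mlog ((u (embIter k y) : Matrix.specialUnitaryGroup (Fin 2) ℂ) : Matrix (Fin 2) (Fin 2) ℂ)‖ ≤ 2 * σ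
    ∧ expHerm ((-Complex.I) • mlog ((u (embIter k y) : Matrix.specialUnitaryGroup (Fin 2) ℂ) : Matrix (Fin 2) (Fin 2) ℂ)) = u (embIter k y) := by
  have hd : ‖((u (embIter k y) : Matrix.specialUnitaryGroup (Fin 2) ℂ) : Matrix (Fin 2) (Fin 2) ℂ) - 1‖ ≤ σ := by rw [← SU2Mean.dist1_eq_norm]; exact hσ y
  have h3 : ‖((u (embIter k y) : Matrix.specialUnitaryGroup (Fin 2) ℂ) : Matrix (Fin 2) (Fin 2) ℂ) - 1‖ ≤ 1 / 3 := hd.trans hσ3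
  have hm := Matrix.mem_specialUnitaryGroup_iff.1 (u (embIter k y)).2
  refine ⟨hermLog_isHermitian hm.1 h3, hermLog_trace hm.2 h3, ?_, expHerm_hermLog _ h3⟩
  exact (norm_hermLog_le (h3.trans (by norm_num))).trans (by linarith)

end Letters

/-! ## §2 The smooth untwisting on T³ -/

section Assembly

/-- ★★★ **THE SMOOTH UNTWISTED CHART OF A σ-TWISTED LANDAU REPRESENTATIVE — BOTH (E1) DATA ROWS.**  T³ run `F.P K`, `1 ≤ K − n`, `ℓ = L^{K−n}`; `W` the background;
`X = e^{iA₀}W` with `A₀` Hermitian-traceless, `‖A₀ b‖ ≤ s ≤ 1∕64`; a twist `u` with `X^u ∈ (6)(e) ∩ 𝔅_k(V)` and centre values `dist1(u(c_y)) ≤ σ ≤ 1∕1024`; bi-contractive frames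
`Fr_y` normalised at their centres with rows `a₀` (holonomy size) and `a₁` (same-direction holonomy difference) on the window `∀ ν, y_ν − Q_ν(z) ∈ {−1,0,1,2}` against
`𝒰 = unitsField (toUField W)`; any `B₁ ≥ (6∕ℓ + 2a₀)·2σ` with `B₁ ≤ 1∕256` and `B₂ ≥ (2(a₁+2a₀²) + 4a₀(6∕ℓ) + 24∕ℓ²)·2σ`.  THEN there is a Hermitian-traceless `D‴` with
`‖D‴ b‖ ≤ s + (1 + 2s)(1 + 6σ)B₁`, `‖divB 𝒰 D‴ x‖ ≤ ‖divB 𝒰 A₀ x‖ + d·(B₂ + 9B₁² + 36σB₂) + d·(6B₁s + 4s(1+6σ)B₁)`, `A(X^u) = A(e^{iD‴}W)`, `e^{iD‴}W ∈ (6)(e) ∩ 𝔅_k(V)`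
— namely `D‴ = −i·log((X^g)_bW_b⁻¹)` for `g = expHerm ∘ Φ`, `Φ` the framed C¹ corner blend of `−i·log u(c_y)`.  With ✓p663714's frames (`ℓa₀, ℓ²a₁ ≤ C′e^{C′}`) both rows are
k-uniform: `ℓB₁ = O(σ)`, `ℓ²B₂ = O(σ)`. [cite: Balaban1985RegularSpaces, (1.29) p.81, (1.36) p.82, (1.72) p.88; Balaban1985Variational, (4)-(6) p.278, (15) p.280; Balaban1985BackgroundPropagators, (3.35) p.396, (3.8) p.392] -/
theorem exists_smoothUntwistedChart_T3 (F : T3Family) {n K : ℕ} (h : n ≤ K) (hk1 : 1 ≤ K - n) {e s σ a₀ a₁ B₁ B₂ : ℝ} (he : 0 ≤ e)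
    {V : GaugeField (F.P n) 0 (Matrix.specialUnitaryGroup (Fin 2) ℂ)} (W : GaugeField (F.P K) 0 (Matrix.specialUnitaryGroup (Fin 2) ℂ))
    (A₀ : PBond (F.P K) 0 → Matrix (Fin 2) (Fin 2) ℂ) (hA0 : ∀ b, (A₀ b).IsHermitian ∧ Matrix.trace (A₀ b) = 0) (hs : ∀ b, ‖A₀ b‖ ≤ s) (hs0 : s ≤ 1 / 64)
    (u : GaugeTransf (F.P K) 0 (Matrix.specialUnitaryGroup (Fin 2) ℂ)) (hXu : GaugeField.gaugeAct u (emb15 W (expHermField A₀)) ∈ regFibrePr F n K h e V)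
    (hσ : ∀ y : Site (F.P K) (K - n), dist1 (u (embIter (K - n) y)) ≤ σ) (hσ0 : σ ≤ 1 / 1024)
    (Fr : Site (F.P K) (K - n) → Site (F.P K) 0 → (Matrix (Fin 2) (Fin 2) ℂ)ˣ)
    (hFr : ∀ y z, ‖(Fr y z : Matrix (Fin 2) (Fin 2) ℂ)‖ ≤ 1 ∧ ‖(((Fr y z)⁻¹ : (Matrix (Fin 2) (Fin 2) ℂ)ˣ) : Matrix (Fin 2) (Fin 2) ℂ)‖ ≤ 1) (hFr1 : ∀ y, Fr y (embIter (K - n) y) = 1)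
    (ha₀ : 0 ≤ a₀) (ha₁ : 0 ≤ a₁)
    (hA : ∀ (y : Site (F.P K) (K - n)) (z : Site (F.P K) 0), (∀ ν : Fin (F.P K).d, (y ν = (iterBlockOf (K - n) (fun κ => z κ - (((((F.P K).L ^ (K - n) - 1) / 2 : ℕ)) : ZMod ((F.P K).sitesPerDir 0)))) ν - 1 ∨ y ν = (iterBlockOf (K - n) (fun κ => z κ - (((((F.P K).L ^ (K - n) - 1) / 2 : ℕ)) : ZMod ((F.P K).sitesPerDir 0)))) ν ∨ y ν = (iterBlockOf (K - n) (fun κ => z κ - (((((F.P K).L ^ (K - n) - 1) / 2 : ℕ)) : ZMod ((F.P K).sitesPerDir 0)))) ν + 1 ∨ y ν = (iterBlockOf (K - n) (fun κ => z κ - (((((F.P K).L ^ (K - n) - 1) / 2 : ℕ)) : ZMod ((F.P K).sitesPerDir 0)))) ν + 2)) → ∀ μ : Fin (F.P K).d,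
      ‖(((Fr y z)⁻¹ * unitsField (toUField W) ⟨z, μ⟩ * Fr y (torusT (F.P K) 0 μ z) : (Matrix (Fin 2) (Fin 2) ℂ)ˣ) : Matrix (Fin 2) (Fin 2) ℂ) - 1‖ ≤ a₀
      ∧ ‖(((Fr y ((torusT (F.P K) 0 μ).symm z))⁻¹ * unitsField (toUField W) ⟨(torusT (F.P K) 0 μ).symm z, μ⟩ * Fr y z : (Matrix (Fin 2) (Fin 2) ℂ)ˣ) : Matrix (Fin 2) (Fin 2) ℂ) - 1‖ ≤ a₀
      ∧ ‖(((Fr y z)⁻¹ * unitsField (toUField W) ⟨z, μ⟩ * Fr y (torusT (F.P K) 0 μ z) : (Matrix (Fin 2) (Fin 2) ℂ)ˣ) : Matrix (Fin 2) (Fin 2) ℂ)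
          - (((Fr y ((torusT (F.P K) 0 μ).symm z))⁻¹ * unitsField (toUField W) ⟨(torusT (F.P K) 0 μ).symm z, μ⟩ * Fr y z : (Matrix (Fin 2) (Fin 2) ℂ)ˣ) : Matrix (Fin 2) (Fin 2) ℂ)‖ ≤ a₁)
    (hB₁ : (6 / ((((F.P K).L ^ (K - n) : ℕ)) : ℝ) + 2 * a₀) * (2 * σ) ≤ B₁) (hB₁' : B₁ ≤ 1 / 256)
    (hB₂ : (2 * (a₁ + 2 * a₀ ^ 2) + 4 * a₀ * (6 / ((((F.P K).L ^ (K - n) : ℕ)) : ℝ)) + 24 / ((((F.P K).L ^ (K - n) : ℕ)) : ℝ) ^ 2) * (2 * σ) ≤ B₂) :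
    ∃ D : PBond (F.P K) 0 → Matrix (Fin 2) (Fin 2) ℂ,
      (∀ b, (D b).IsHermitian ∧ Matrix.trace (D b) = 0) ∧
      (∀ b, ‖D b‖ ≤ s + (1 + 2 * s) * ((1 + 6 * σ) * B₁)) ∧
      (∀ x, ‖divB (torusT (F.P K) 0) (fun κ z => unitsField (toUField W) ⟨z, κ⟩) (fun μ z => D ⟨z, μ⟩) x‖
          ≤ ‖divB (torusT (F.P K) 0) (fun κ z => unitsField (toUField W) ⟨z, κ⟩) (fun μ z => A₀ ⟨z, μ⟩) x‖
            + ((F.P K).d : ℝ) * (B₂ + 9 * B₁ ^ 2 + 36 * σ * B₂) + ((F.P K).d : ℝ) * (6 * B₁ * s + 4 * s * ((1 + 6 * σ) * B₁))) ∧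
      wilsonAction4 (GaugeField.gaugeAct u (emb15 W (expHermField A₀))) = wilsonAction4 (emb15 W (expHermField D)) ∧
      emb15 W (expHermField D) ∈ regFibrePr F n K h e V := by
  -- bookkeeping of sizes
  have hk : K - n ≤ (F.P K).m + (F.P K).K := by show K - n ≤ F.m + K; omega
  have hL2 : 2 ≤ (F.P K).L := by have := (F.P K).hL.2; omega
  have hℓ2 : 2 ≤ (F.P K).L ^ (K - n) := hL2.trans (Nat.le_self_pow (by omega) _)
  have hℓR : (2 : ℝ) ≤ ((((F.P K).L ^ (K - n) : ℕ)) : ℝ) := by exact_mod_cast hℓ2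
  have hσnn : 0 ≤ σ := (GaugeGroup.dist1_nonneg _).trans (hσ (Classical.arbitrary _))
  have hM : 0 ≤ 2 * σ := by positivity
  have hsnn : 0 ≤ s := (norm_nonneg _).trans (hs ⟨Classical.arbitrary _, ⟨0, (F.P K).hd⟩⟩)
  have hB1nn : 0 ≤ B₁ := le_trans (by positivity) hB₁
  have hs1 : s ≤ 1 := hs0.trans (by norm_num)
  -- the profile, the centre data, the background
  obtain ⟨hp0, hpℓ, hp01, hpS, hpD, hpc, hpk⟩ := profile_rows (P := F.P K) (k := K - n) hℓ2
  have hcd := fun y => centre_data_rows (k := K - n) u hσ (hσ0.trans (by norm_num)) y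
  have hU : ∀ (κ : Fin (F.P K).d) (z : Site (F.P K) 0), ‖(((fun κ z => unitsField (toUField W) ⟨z, κ⟩) κ z : (Matrix (Fin 2) (Fin 2) ℂ)ˣ) : Matrix (Fin 2) (Fin 2) ℂ)‖ ≤ 1 ∧ ‖(((((fun κ z => unitsField (toUField W) ⟨z, κ⟩) κ z)⁻¹ : (Matrix (Fin 2) (Fin 2) ℂ)ˣ)) : Matrix (Fin 2) (Fin 2) ℂ)‖ ≤ 1 :=
    fun κ z => unitsField_toUField_norm_le_one W ⟨z, κ⟩
  -- (U1): the framed corner blend of the centre data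
  obtain ⟨Φ, hΦc, hΦw, hΦ0, hΦ1, hΦ2⟩ := exists_extension_sup_rows (𝔸 := Matrix (Fin 2) (Fin 2) ℂ) hk (fun r : ℕ => (1 - (r : ℝ) / ((((F.P K).L ^ (K - n) : ℕ)) : ℝ)) ^ 2 * (1 + 2 * (r : ℝ) / ((((F.P K).L ^ (K - n) : ℕ)) : ℝ))) hp0 hpℓ hp01 hpS hpD hpc hpk (fun κ z => unitsField (toUField W) ⟨z, κ⟩) hU Fr hFr hFr1
    (fun y => (-Complex.I) • mlog ((u (embIter (K - n) y) : Matrix.specialUnitaryGroup (Fin 2) ℂ) : Matrix (Fin 2) (Fin 2) ℂ)) hM (fun y => (hcd y).2.2.1) a₀ a₁ ha₀ ha₁ hA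
  have hΦh : ∀ z, (Φ z).IsHermitian ∧ Matrix.trace (Φ z) = 0 := by
    intro z
    obtain ⟨w, -, -, hz⟩ := hΦw z
    rw [hz]
    exact isHermitian_trace_sum_smul w _ fun y => isHermitian_trace_R (Fr y z) (hFr y z) ⟨(hcd y).1, (hcd y).2.1⟩
  have hΦ1' : ∀ (μ : Fin (F.P K).d) (z : Site (F.P K) 0), ‖covD (torusT (F.P K) 0) (fun κ z => unitsField (toUField W) ⟨z, κ⟩) μ Φ z‖ ≤ B₁ := fun μ z => (hΦ1 μ z).trans hB₁
  have hΦ2' : ∀ (μ : Fin (F.P K).d) (z : Site (F.P K) 0), ‖covDstar (torusT (F.P K) 0) (fun κ z => unitsField (toUField W) ⟨z, κ⟩) μ (covD (torusT (F.P K) 0) (fun κ z => unitsField (toUField W) ⟨z, κ⟩) μ Φ) z‖ ≤ B₂ :=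
    fun μ z => (hΦ2 μ z).trans hB₂
  -- (U2): the pure-gauge part of `g = expHerm ∘ Φ`
  have h2σ128 : 2 * σ ≤ 1 / 128 := by linarith
  have h2σ512 : 2 * σ ≤ 1 / 512 := by linarith
  have hB₁16 : B₁ ≤ 1 / 16 := hB₁'.trans (by norm_num)
  have hexp : Real.exp (2 * σ) ≤ 3 := by
    have h1 : Real.exp (2 * σ) ≤ Real.exp 1 := Real.exp_le_exp.2 (by linarith)
    have := Real.exp_one_lt_d9; linarith
  have hq : ∀ b : PBond (F.P K) 0, ‖((GaugeField.gaugeAct (fun z => expHerm (Φ z)) W b * (W b)⁻¹ : Matrix.specialUnitaryGroup (Fin 2) ℂ) : Matrix (Fin 2) (Fin 2) ℂ) - 1‖ ≤ 3 * B₁ := by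
    rintro ⟨x, μ⟩
    refine (norm_ratio_sub_one_le Φ hΦh W hΦ0 μ x).trans ?_
    calc ‖covD (torusT (F.P K) 0) (fun κ z => unitsField (toUField W) ⟨z, κ⟩) μ Φ x‖ * Real.exp (2 * σ) ≤ B₁ * 3 := mul_le_mul (hΦ1' μ x) hexp (Real.exp_pos _).le hB1nn
      _ = 3 * B₁ := by ring
  have hγ : ∀ b : PBond (F.P K) 0, ‖(-Complex.I) • mlog ((GaugeField.gaugeAct (fun z => expHerm (Φ z)) W b * (W b)⁻¹ : Matrix.specialUnitaryGroup (Fin 2) ℂ) : Matrix (Fin 2) (Fin 2) ℂ)‖ ≤ (1 + 6 * σ) * B₁ := by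
    rintro ⟨x, μ⟩
    have := norm_pureGauge_le W Φ hΦh hΦ0 h2σ128 hΦ1' hB₁16 μ x
    calc _ ≤ (1 + 3 * (2 * σ)) * B₁ := this
      _ = (1 + 6 * σ) * B₁ := by ring
  have hdivG : ∀ x : Site (F.P K) 0, ‖divB (torusT (F.P K) 0) (fun κ z => unitsField (toUField W) ⟨z, κ⟩)
      (fun μ z => (-Complex.I) • mlog ((GaugeField.gaugeAct (fun z => expHerm (Φ z)) W ⟨z, μ⟩ * (W ⟨z, μ⟩)⁻¹ : Matrix.specialUnitaryGroup (Fin 2) ℂ) : Matrix (Fin 2) (Fin 2) ℂ)) x‖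
        ≤ ((F.P K).d : ℝ) * B₂ + ((F.P K).d : ℝ) * (9 * B₁ ^ 2 + 18 * (2 * σ) * B₂) :=
    fun x => norm_divB_pureGauge_le W Φ hΦh hΦ0 h2σ512 hΦ1' hB₁' hΦ2' x
  -- (U2b): the chart of `X^g`
  have hw3 : 2 * s + 3 * B₁ ≤ 1 / 3 := by linarith
  have hw5 : 7 * s + 2 * (2 * s + 3 * B₁) ≤ 1 / 5 := by linarith
  refine ⟨fun b => (-Complex.I) • mlog ((GaugeField.gaugeAct (fun z => expHerm (Φ z)) (emb15 W (expHermField A₀)) b * (W b)⁻¹ : Matrix.specialUnitaryGroup (Fin 2) ℂ) : Matrix (Fin 2) (Fin 2) ℂ),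
    fun b => chart_gaugeAct_isHermitian_trace F W A₀ hA0 _ hs hs1 hq hw3 b, fun b => ?_, fun x => ?_, ?_⟩
  · have := norm_chart_gaugeAct_le F W A₀ hA0 (fun z => expHerm (Φ z)) hs hs1 hq hγ hw5 b
    calc _ ≤ s + (1 + 6 * σ) * B₁ + 2 * s * ((1 + 6 * σ) * B₁) := this
      _ = s + (1 + 2 * s) * ((1 + 6 * σ) * B₁) := by ring
  · have h1 := norm_divB_chart_gaugeAct_le F W A₀ (fun z => expHerm (Φ z)) hA0 hs hs1 hq hγ hw5 x
    have h2 := hdivG x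
    have e3 : ((F.P K).d : ℝ) * B₂ + ((F.P K).d : ℝ) * (9 * B₁ ^ 2 + 18 * (2 * σ) * B₂) = ((F.P K).d : ℝ) * (B₂ + 9 * B₁ ^ 2 + 36 * σ * B₂) := by ring
    have e4 : ((F.P K).d : ℝ) * (2 * (3 * B₁) * s + 4 * s * ((1 + 6 * σ) * B₁)) = ((F.P K).d : ℝ) * (6 * B₁ * s + 4 * s * ((1 + 6 * σ) * B₁)) := by ring
    linarith [h1, h2, e3, e4]
  · -- centre values, membership, the chart identity, the action
    have hc : ∀ y : Site (F.P K) (K - n), (fun z => expHerm (Φ z)) (embIter (K - n) y) = u (embIter (K - n) y) := by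
      intro y
      show expHerm (Φ (embIter (K - n) y)) = _
      rw [hΦc y]
      exact (hcd y).2.2.2
    have hmem := gaugeAct_mem_regFibrePr_of_centre_eq F h he (g := fun z => expHerm (Φ z)) hc hXu
    have hthird : ∀ b : PBond (F.P K) 0,
        ‖((GaugeField.gaugeAct (fun z => expHerm (Φ z)) (emb15 W (expHermField A₀)) b * (W b)⁻¹ : Matrix.specialUnitaryGroup (Fin 2) ℂ) : Matrix (Fin 2) (Fin 2) ℂ) - 1‖ ≤ 1 / 3 := by
      intro b
      have e1 : ((GaugeField.gaugeAct (fun z => expHerm (Φ z)) (emb15 W (expHermField A₀)) b * (W b)⁻¹ : Matrix.specialUnitaryGroup (Fin 2) ℂ) : Matrix (Fin 2) (Fin 2) ℂ) - 1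
          = BlockAveragingEMLLinearisedBackground.pertVar W (GaugeField.gaugeAct (fun z => expHerm (Φ z)) (emb15 W (expHermField A₀))) b := by
        rw [BlockAveragingEMLLinearisedBackground.pertVar_eq, Submonoid.coe_mul, coe_inv_SU]
      rw [e1]
      exact (Prop7GaugeActChartRows.norm_pertVar_gaugeAct_emb15_le F W A₀ hA0 _ hs hs1 b).trans ((add_le_add le_rfl (hq b)).trans hw3)
    have hcfg : emb15 W (expHermField fun b => (-Complex.I) • mlog ((GaugeField.gaugeAct (fun z => expHerm (Φ z)) (emb15 W (expHermField A₀)) b * (W b)⁻¹ : Matrix.specialUnitaryGroup (Fin 2) ℂ) : Matrix (Fin 2) (Fin 2) ℂ))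
        = GaugeField.gaugeAct (fun z => expHerm (Φ z)) (emb15 W (expHermField A₀)) := by
      funext b
      show expHerm ((-Complex.I) • mlog ((GaugeField.gaugeAct (fun z => expHerm (Φ z)) (emb15 W (expHermField A₀)) b * (W b)⁻¹ : Matrix.specialUnitaryGroup (Fin 2) ℂ) : Matrix (Fin 2) (Fin 2) ℂ)) * W b = _
      rw [expHerm_hermLog _ (hthird b), inv_mul_cancel_right]
    refine ⟨?_, by rw [hcfg]; exact hmem⟩
    rw [hcfg, show wilsonAction4 (GaugeField.gaugeAct u (emb15 W (expHermField A₀))) = wilsonAction4 (emb15 W (expHermField A₀)) from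
      T4WilsonGaugeFlatDirection.wilsonAction_gaugeAct 1 u _]
    exact (T4WilsonGaugeFlatDirection.wilsonAction_gaugeAct 1 _ _).symm

end Assembly

end Summit.QuantumFields.YangMills.Theorems.Prop7SmoothUntwist

end
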